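import Summits.HodgeConjecture.CorCM.Census.CoinvariantSplitTypes

/-!
# The coinvariant fibre `φ₂(G, c)`, X: `|G|/2` ODD (`|G| ≡ 2 mod 4`) — `φ₂ = β − 1` EXACTLY, by the half-norm over a CM type

COR-CM (cell `pub-hodgecm2`), count-neutral kernel combinatorics by the binder seat b09 (gen 29; lane COINVARIANT-FLOOR, addendum),
part X, sequel of `Census/CoinvariantSplitTypes.lean` (VII).  Theorems only; no `decide` beyond numerals of `ZMod 2`, no certificate,
no named fact, no `sorry`.  HONEST FRAMING: `HC_CM` is NOT proved; nothing here is a period or a headline.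

THE THEOREM (`fibreTwo_add_one_eq_card_block_of_odd_half`).  Let `c` be a central involution of the finite group `G` with `|G|/2`
ODD (`|G| ≡ 2 (mod 4)`; then `G = ⟨c⟩ × A` with `|A|` odd — b17's `OddDegreeParityLaw` domain, André-3's `ℤ/6×ℤ/3 31`, every
`ℤ/2 × A`).  Then **`φ₂(G, c) + 1 = β(G, c)`**: the coinvariant floor is the parity floor `β − 1` (here `δ = 0`), for abelian
and non-abelian `A` alike, no census.

PROOF (Maschke for the odd group `G/⟨c⟩`, made explicit).  For a CM type `T` — a transversal of `⟨c⟩` — put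
`E_T z = Σ_{y ∈ T} z·y⁻¹` (the half-norm).  Modulo `pair2`: `E_T` does not depend on `T` (`sum_rt_sub_sum_rt_mem_pair2`: two
transversals differ by `c`-factors and a `c`-coboundary is a sum of pairs, part VII), hence `E_T(z·Q⁻¹) ≡ E_{T·Q} z ≡ E_T z`
(`sum_rt_mapDomain_sub_mem_pair2`) and `E_T` kills the augmentation submodule `ker par2` modulo pairs
(`sum_rt_mem_pair2_of_par2_eq_zero`, with part V §3).  When `|T| = |G|/2` is odd, `x = E_T x + Σ_{y ∈ T} (x·y⁻¹ − x)` in characteristic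
`2`; for `x ∈ hodge2 ∩ ker par2` the first term is in `pair2` and each summand is in `rad2` (part I `mapDomain_rt_sub_mem_rad2`), so
**`hodge2 ∩ ker par2 ≤ rad2`** (`mem_rad2_of_par2_eq_zero_of_odd_half`) and `φ₂ ≤ dim par2(hodge2) = β − 1 − δ`; with part II's
domination and gen 28's transfer criterion (`c^{|G|/2} = c ≠ 1 ⇒ δ = 0`) the equality follows.

## References
* [Pohlmann1968] H. Pohlmann, Algebraic cycles on abelian varieties of complex multiplication type, Ann. of Math. 88 (1968), Thm 1.
-/

namespace Summit.HodgeConjecture.CorCM.Census.Coinvariant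

open Finset
open Summit.HodgeConjecture.CorCM.Prior.AllgGroup.RfwfAllgGroup
open Summit.HodgeConjecture.CorCM.Census.BlockParity

noncomputable section

variable {G : Type*} [Group G] [Fintype G] [DecidableEq G] (c : G)

/-! ## §1 Two transversals: the half-norm is well defined modulo pairs -/

/-- A CM type `T₁` is obtained from a CM type `T₀` by replacing the elements of `D = T₀ ∖ T₁` by their `c`-multiples.
[folklore] -/
theorem val_eq_sdiff_union_image (hc2 : c * c = 1) (T₀ T₁ : CMF G c) :
    T₁.1 = (T₀.1 \ (T₀.1 \ T₁.1)) ∪ (T₀.1 \ T₁.1).image (fun y => c * y) := by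
  ext y
  rw [Finset.mem_union, Finset.mem_sdiff, Finset.mem_sdiff, Finset.mem_image]
  constructor
  · intro hy1
    by_cases hy0 : y ∈ T₀.1
    · exact Or.inl ⟨hy0, fun h => h.2 hy1⟩
    · refine Or.inr ⟨c * y, Finset.mem_sdiff.mpr ⟨?_, (T₁.2 y).mp hy1⟩, by rw [← mul_assoc, hc2, one_mul]⟩
      by_contra h; exact hy0 ((T₀.2 y).mpr h)
  · rintro (⟨hy0, hn⟩ | ⟨y', hy', rfl⟩)
    · by_contra h; exact hn ⟨hy0, h⟩
    · rw [Finset.mem_sdiff] at hy'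
      by_contra h
      exact hy'.2 ((T₁.2 y').mpr h)

/-- **The half-norm modulo pairs does not depend on the transversal**: `Σ_{y ∈ T₀} z·y⁻¹ − Σ_{y ∈ T₁} z·y⁻¹ ∈ pair2`. [folklore] -/
theorem sum_rt_sub_sum_rt_mem_pair2 (hc2 : c * c = 1) (T₀ T₁ : CMF G c) (z : CMF G c →₀ ZMod 2) :
    ∑ y ∈ T₀.1, Finsupp.mapDomain (rt c y) z - ∑ y ∈ T₁.1, Finsupp.mapDomain (rt c y) z ∈ pair2 c := by
  set D := T₀.1 \ T₁.1 with hD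
  have hDsub : D ⊆ T₀.1 := Finset.sdiff_subset
  have hdisj : Disjoint (T₀.1 \ D) (D.image fun y => c * y) := by
    rw [Finset.disjoint_left]
    rintro y hy hy'
    rw [Finset.mem_sdiff] at hy
    obtain ⟨y', hy'D, rfl⟩ := Finset.mem_image.mp hy'
    exact ((T₀.2 y').mp (hDsub hy'D)) hy.1
  have hinj : Set.InjOn (fun y => c * y) ↑D := fun a _ b _ h => mul_left_cancel h
  rw [val_eq_sdiff_union_image c hc2 T₀ T₁, ← hD, Finset.sum_union hdisj, Finset.sum_image hinj,
    ← Finset.sum_sdiff hDsub]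
  have e : ∑ y ∈ T₀.1 \ D, Finsupp.mapDomain (rt c y) z + ∑ y ∈ D, Finsupp.mapDomain (rt c y) z -
      (∑ y ∈ T₀.1 \ D, Finsupp.mapDomain (rt c y) z + ∑ y ∈ D, Finsupp.mapDomain (rt c (c * y)) z) =
      -∑ y ∈ D, (Finsupp.mapDomain (rt c c) (Finsupp.mapDomain (rt c y) z) - Finsupp.mapDomain (rt c y) z) := by
    simp only [mapDomain_rt_mul, Finset.sum_sub_distrib]; abel
  rw [e]
  exact Submodule.neg_mem _ (Submodule.sum_mem _ fun y _ => mapDomain_rt_self_sub_mem_pair2 c _)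

/-- **Translation invariance of the half-norm modulo pairs**: `Σ_{y ∈ T} (z·Q⁻¹)·y⁻¹ − Σ_{y ∈ T} z·y⁻¹ ∈ pair2`. [folklore] -/
theorem sum_rt_mapDomain_sub_mem_pair2 (hc2 : c * c = 1) (T₀ : CMF G c) (Q : G) (z : CMF G c →₀ ZMod 2) :
    ∑ y ∈ T₀.1, Finsupp.mapDomain (rt c y) (Finsupp.mapDomain (rt c Q) z) - ∑ y ∈ T₀.1, Finsupp.mapDomain (rt c y) z ∈
      pair2 c := by
  have h1 : ∑ y ∈ T₀.1, Finsupp.mapDomain (rt c y) (Finsupp.mapDomain (rt c Q) z) =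
      ∑ y ∈ (rt c Q⁻¹ T₀).1, Finsupp.mapDomain (rt c y) z := by
    have himg : (rt c Q⁻¹ T₀).1 = T₀.1.image (fun y => y * Q) := by
      ext P
      rw [mem_rt, Finset.mem_image]
      constructor
      · intro h; exact ⟨P * Q⁻¹, h, by rw [inv_mul_cancel_right]⟩
      · rintro ⟨y, hy, rfl⟩; rwa [mul_inv_cancel_right]
    rw [himg, Finset.sum_image (fun a _ b _ h => mul_right_cancel h)]
    exact Finset.sum_congr rfl fun y _ => by rw [← mapDomain_rt_mul]
  rw [h1]
  have h2 := sum_rt_sub_sum_rt_mem_pair2 c hc2 T₀ (rt c Q⁻¹ T₀) z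
  have e : ∑ y ∈ (rt c Q⁻¹ T₀).1, Finsupp.mapDomain (rt c y) z - ∑ y ∈ T₀.1, Finsupp.mapDomain (rt c y) z =
      -(∑ y ∈ T₀.1, Finsupp.mapDomain (rt c y) z - ∑ y ∈ (rt c Q⁻¹ T₀).1, Finsupp.mapDomain (rt c y) z) := by abel
  rw [e]
  exact Submodule.neg_mem _ h2

/-- **The half-norm kills the augmentation submodule modulo pairs**: `par2 x = 0 ⇒ Σ_{y ∈ T} x·y⁻¹ ∈ pair2`. [folklore] -/
theorem sum_rt_mem_pair2_of_par2_eq_zero (hc2 : c * c = 1) (T₀ : CMF G c) {x : CMF G c →₀ ZMod 2} (hx : par2 c x = 0) :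
    ∑ y ∈ T₀.1, Finsupp.mapDomain (rt c y) x ∈ pair2 c := by
  set E : (CMF G c →₀ ZMod 2) →ₗ[ZMod 2] (CMF G c →₀ ZMod 2) := ∑ y ∈ T₀.1, Finsupp.lmapDomain (ZMod 2) (ZMod 2) (rt c y)
    with hE
  have hEap : ∀ z, E z = ∑ y ∈ T₀.1, Finsupp.mapDomain (rt c y) z := fun z => by
    rw [hE, LinearMap.sum_apply]; rfl
  have hle : Submodule.span (ZMod 2)
      {y : CMF G c →₀ ZMod 2 | ∃ (Q : G) (z : CMF G c →₀ ZMod 2), y = Finsupp.mapDomain (rt c Q) z - z} ≤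
      Submodule.comap E (pair2 c) := by
    rw [Submodule.span_le]
    rintro _ ⟨Q, z, rfl⟩
    rw [SetLike.mem_coe, Submodule.mem_comap, map_sub, hEap, hEap]
    exact sum_rt_mapDomain_sub_mem_pair2 c hc2 T₀ Q z
  have h := hle (mem_span_cobdryAll_of_par2_eq_zero c hx)
  rw [Submodule.mem_comap, hEap] at h
  exact h

/-! ## §2 A CM type has `|G|/2` elements -/

/-- **A CM type has exactly `|G|/2` members** (`G = T ⊔ cT`). [folklore] -/
theorem two_mul_card_val (hc2 : c * c = 1) (T₀ : CMF G c) : 2 * T₀.1.card = Fintype.card G := by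
  classical
  have hdisj : Disjoint T₀.1 (T₀.1.image fun y => c * y) := by
    rw [Finset.disjoint_left]
    rintro y hy hy'
    obtain ⟨y', hy'0, rfl⟩ := Finset.mem_image.mp hy'
    exact ((T₀.2 y').mp hy'0) hy
  have himg : (T₀.1.image fun y => c * y).card = T₀.1.card :=
    Finset.card_image_of_injective _ (mul_right_injective c)
  have huniv : T₀.1 ∪ T₀.1.image (fun y => c * y) = Finset.univ := by
    refine Finset.eq_univ_of_forall fun y => ?_
    rw [Finset.mem_union]
    by_cases hy : y ∈ T₀.1
    · exact Or.inl hy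
    · refine Or.inr (Finset.mem_image.mpr ⟨c * y, ?_, by rw [← mul_assoc, hc2, one_mul]⟩)
      by_contra h; exact hy ((T₀.2 y).mpr h)
  rw [← Finset.card_univ, ← huniv, Finset.card_union_of_disjoint hdisj, himg]
  ring

/-! ## §3 `hodge2 ∩ ker par2 ≤ rad2` and `φ₂ + 1 = β` when `|G|/2` is odd -/

/-- **KEY (`|G|/2` odd)**: a Hodge vector mod `2` with zero block sums lies in `rad2` — `x = E_T x + Σ_{y ∈ T} (x·y⁻¹ − x)` in
characteristic `2` when `|T|` is odd. [folklore] -/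
theorem mem_rad2_of_par2_eq_zero_of_odd_half (hc2 : c * c = 1) (hc1 : c ≠ 1) (hcen : ∀ x : G, x * c = c * x)
    (hodd : Odd (Fintype.card G / 2)) {x : CMF G c →₀ ZMod 2} (hx : x ∈ hodge2 c hc2) (hpx : par2 c x = 0) :
    x ∈ rad2 c hc2 := by
  obtain ⟨T, hT⟩ := exists_isCMF c hc2 hc1
  set T₀ : CMF G c := ⟨T, hT⟩
  have hcard : Odd T₀.1.card := by
    have h := two_mul_card_val c hc2 T₀
    have : Fintype.card G / 2 = T₀.1.card := by omega
    rwa [this] at hodd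
  have hsum : ∑ y ∈ T₀.1, (Finsupp.mapDomain (rt c y) x - x) = ∑ y ∈ T₀.1, Finsupp.mapDomain (rt c y) x - x := by
    rw [Finset.sum_sub_distrib, Finset.sum_const, ← Nat.cast_smul_eq_nsmul (ZMod 2),
      (ZMod.natCast_eq_one_iff_odd).mpr hcard, one_smul]
  have e : x = ∑ y ∈ T₀.1, Finsupp.mapDomain (rt c y) x - ∑ y ∈ T₀.1, (Finsupp.mapDomain (rt c y) x - x) := by
    rw [hsum]; abel
  rw [e]
  exact Submodule.sub_mem _ (pair2_le_rad2 c hc2 (sum_rt_mem_pair2_of_par2_eq_zero c hc2 T₀ hpx))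
    (Submodule.sum_mem _ fun y _ => mapDomain_rt_sub_mem_rad2 c hc2 hcen y hx)

/-- **`φ₂ ≤ dim par2(hodge2)`** when `|G|/2` is odd. [folklore] -/
theorem fibreTwo_le_finrank_span_par_of_odd_half (hc2 : c * c = 1) (hc1 : c ≠ 1) (hcen : ∀ x : G, x * c = c * x)
    (hodd : Odd (Fintype.card G / 2)) :
    fibreTwo c hc2 ≤ Module.finrank (ZMod 2) ↥(Submodule.span (ZMod 2) (par c '' gfaceSet G c hc2)) := by
  rw [span_par_gfaceSet_eq_map, ← map_par2_hodge2]
  have h1 := LinearMap.finrank_range_add_finrank_ker (V := ↥(hodge2 c hc2)) ((par2 c).domRestrict (hodge2 c hc2))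
  rw [LinearMap.range_domRestrict, LinearMap.ker_domRestrict] at h1
  have h2 : Submodule.comap (hodge2 c hc2).subtype (LinearMap.ker (par2 c)) ≤
      Submodule.comap (hodge2 c hc2).subtype (rad2 c hc2) := fun v hv =>
    mem_rad2_of_par2_eq_zero_of_odd_half c hc2 hc1 hcen hodd v.2 (LinearMap.mem_ker.mp hv)
  have h3 := Submodule.finrank_mono h2
  rw [(Submodule.comapSubtypeEquivOfLe (rad2_le_hodge2 c hc2)).finrank_eq] at h3
  have h4 := finrank_rad2_add_fibreTwo c hc2
  omega

/-- **THE ODD-HALF COINVARIANT THEOREM: `φ₂(G, c) + 1 = β(G, c)` whenever `|G|/2` is odd** (`|G| ≡ 2 mod 4`: every `ℤ/2 × A`,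
`|A|` odd, abelian or not). [folklore] -/
theorem fibreTwo_add_one_eq_card_block_of_odd_half (hc2 : c * c = 1) (hc1 : c ≠ 1) (hcen : ∀ x : G, x * c = c * x)
    (hodd : Odd (Fintype.card G / 2)) : fibreTwo c hc2 + 1 = Fintype.card (Block c) := by
  obtain ⟨T, hT⟩ := exists_isCMF c hc2 hc1
  have h1 := finrank_span_par_gfaceSet_add c hc2 ⟨T, hT⟩
  have h2 := fibreTwo_le_finrank_span_par_of_odd_half c hc2 hc1 hcen hodd
  have h3 := card_block_le_fibreTwo_add c hc2 ⟨T, hT⟩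
  have hpow : c ^ (Fintype.card G / 2) ≠ 1 := by
    obtain ⟨k, hk⟩ := hodd
    rw [hk, pow_succ, pow_mul, pow_two, hc2, one_pow, one_mul]
    exact hc1
  have h4 := wdelta_eq_zero_of_pow_ne_one c hc2 hc1 hcen ⟨T, hT⟩ hpow
  omega

/-- **The two floors coincide when `|G|/2` is odd**: `φ₂ = dim_𝔽₂ span par(faces)` (`= β − 1`). [folklore] -/
theorem fibreTwo_eq_finrank_span_par_of_odd_half (hc2 : c * c = 1) (hc1 : c ≠ 1) (hcen : ∀ x : G, x * c = c * x)
    (hodd : Odd (Fintype.card G / 2)) :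
    fibreTwo c hc2 = Module.finrank (ZMod 2) ↥(Submodule.span (ZMod 2) (par c '' gfaceSet G c hc2)) :=
  le_antisymm (fibreTwo_le_finrank_span_par_of_odd_half c hc2 hc1 hcen hodd) (finrank_span_par_le_fibreTwo c hc2)

end

end Summit.HodgeConjecture.CorCM.Census.Coinvariant
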